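import Literature.AlgebraicGeometry.Resolution.SmoothPointOrderCriterion
import Literature.AlgebraicGeometry.Resolution.DerivativeIdealSheaf
import Literature.AlgebraicGeometry.Motives.SmoothSpread
import Mathlib.RingTheory.RingHom.StandardSmooth
import Mathlib.RingTheory.RingHom.Etale
import Mathlib.AlgebraicGeometry.AffineScheme
import HarnessLib

/-!
# The order criterion by differential operators at closed points of schemes smooth over a perfect field

Topic: `Literature/AlgebraicGeometry/Resolution`. Scheme-level wrapper of `SmoothPointOrderCriterion.lean`: for
`f : Z → Spec K` smooth, `K` a perfect field, and a CLOSED point `ξ ∈ Z`, the local ring `𝒪_{Z,ξ}` with its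
`K`-structure `K → Γ(Z, 𝒪_Z) → 𝒪_{Z,ξ}` (`Resolution.stalkAlgebra`) satisfies: if `h ∈ 𝔪_ξ^N ∖ 𝔪_ξ^{N+1}` then for
every `e` some `K`-linear differential operator of order `≤ eN` (Grothendieck's sense, `IsDiffOpLE`) takes `h^e` to a
unit, and `Diff^{≤ eN}((h^e)) = 𝒪_{Z,ξ}` (the tree's `diffIdeal`). Proof: a standard-smooth affine chart `Γ(Z,V)` at
`ξ` (`Motives.exists_appLE_isStandardSmoothOfRelativeDimension_of_mem_smoothLocus`) is étale over `K[X₁,…,X_d]`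
(Mathlib `RingHom.IsStandardSmoothOfRelativeDimension.exists_etale_mvPolynomial`), `ξ` is a maximal ideal of it
(`IsAffineOpen.primeIdealOf_isMaximal_of_isClosed`) and `𝒪_{Z,ξ}` is the localisation there
(`IsAffineOpen.isLocalization_stalk`); apply `exists_isDiffOpLE_isUnit_pow_of_etaleCoordinates`.
[VillamayorU2008ReesDiff] §4.1, Remark 4.3; [EGAIV4] §16.8, Thm. 16.11.2, §17.
-/

noncomputable section

namespace Literature.AlgebraicGeometry.Resolution

open IsLocalRing CategoryTheory TopologicalSpace _root_.AlgebraicGeometry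

universe u

variable {K : Type u} [Field K] {Z : Scheme.{u}} (f : Z ⟶ Spec (.of K))

/-- **Unit form of the order criterion at a closed point of a smooth scheme over a perfect field, every
characteristic**: for `f : Z → Spec K` smooth with `K` perfect, `ξ ∈ Z` closed, `h ∈ 𝔪_ξ^N ∖ 𝔪_ξ^{N+1}` and every
`e`, some `K`-linear differential operator of `𝒪_{Z,ξ}` of order `≤ eN` takes `h^e` to a unit (the `K`-structure
being `K → Γ(Z,𝒪_Z) → 𝒪_{Z,ξ}`, `Resolution.stalkAlgebra` of `f.appTop ∘ ΓSpecIso⁻¹`).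
[cite: VillamayorU2008ReesDiff, §4.1 and Remark 4.3] [cite: EGAIV4, §16.8 and Thm. 16.11.2] -/
theorem exists_isDiffOpLE_isUnit_pow_stalk_of_smooth [PerfectField K] [Smooth f] (ξ : Z)
    (hξ : IsClosed ({ξ} : Set Z)) {N : ℕ} {h : Z.presheaf.stalk ξ}
    (h1 : h ∈ maximalIdeal (Z.presheaf.stalk ξ) ^ N) (h2 : h ∉ maximalIdeal (Z.presheaf.stalk ξ) ^ (N + 1))
    (e : ℕ) :
    letI := stalkAlgebra (f.appTop.hom.comp (Scheme.ΓSpecIso (.of K)).inv.hom) ξ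
    ∃ D : Z.presheaf.stalk ξ →ₗ[K] Z.presheaf.stalk ξ, IsDiffOpLE K (e * N) D ∧ IsUnit (D (h ^ e)) := by
  set φ₀ : K →+* Γ(Z, ⊤) := f.appTop.hom.comp (Scheme.ΓSpecIso (.of K)).inv.hom with hφ₀
  letI := stalkAlgebra φ₀ ξ
  -- a standard smooth affine chart at `ξ`
  have hx : ξ ∈ f.smoothLocus := by
    rw [Scheme.Hom.smoothLocus_eq_top]
    trivial
  obtain ⟨d, ⟨U, hU⟩, ⟨V, hV⟩, hξV, e', hstd⟩ :=
    Literature.AlgebraicGeometry.Motives.exists_appLE_isStandardSmoothOfRelativeDimension_of_mem_smoothLocus f hx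
  have hUtop : U = ⊤ := by
    ext y
    simp only [Opens.coe_top, Set.mem_univ, iff_true]
    have : f ξ ∈ U := e' hξV
    rwa [Subsingleton.elim y (f ξ)]
  subst hUtop
  -- its `K`-structure is the sections `K`-structure `K → Γ(Z, 𝒪_Z) → Γ(Z, V)`
  have hφ : sectionsHom φ₀ V =
      (f.appLE ⊤ V e').hom.comp (Scheme.ΓSpecIso (.of K)).commRingCatIsoToRingEquiv.symm.toRingHom := rfl
  have hφstd : (sectionsHom φ₀ V).IsStandardSmoothOfRelativeDimension d := by
    rw [hφ]
    exact RingHom.isStandardSmoothOfRelativeDimension_respectsIso.2 _ _ hstd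
  obtain ⟨g, hgC, hgEt⟩ := RingHom.IsStandardSmoothOfRelativeDimension.exists_etale_mvPolynomial hφstd
  -- algebra structures `K → K[X] → Γ(Z, V) → 𝒪_{Z,ξ}`
  letI : Algebra K Γ(Z, V) := sectionsAlgebra φ₀ V
  letI : Algebra (MvPolynomial (Fin d) K) Γ(Z, V) := g.toAlgebra
  haveI : IsScalarTower K (MvPolynomial (Fin d) K) Γ(Z, V) :=
    IsScalarTower.of_algebraMap_eq (R := K) (S := MvPolynomial (Fin d) K) (A := Γ(Z, V)) fun c => by
      show sectionsHom φ₀ V c = g (algebraMap K (MvPolynomial (Fin d) K) c)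
      rw [MvPolynomial.algebraMap_eq, ← hgC]
      rfl
  haveI : Algebra.Etale (MvPolynomial (Fin d) K) Γ(Z, V) := hgEt
  haveI : Algebra.FormallyEtale (MvPolynomial (Fin d) K) Γ(Z, V) := Algebra.Etale.formallyEtale
  haveI : Algebra.FinitePresentation (MvPolynomial (Fin d) K) Γ(Z, V) := Algebra.Etale.finitePresentation
  haveI : Algebra.FiniteType K Γ(Z, V) :=
    Algebra.FiniteType.trans (S := MvPolynomial (Fin d) K) inferInstance inferInstance
  letI : Algebra Γ(Z, V) (Z.presheaf.stalk ξ) := TopCat.Presheaf.algebra_section_stalk Z.presheaf ⟨ξ, hξV⟩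
  haveI : IsLocalization.AtPrime (Z.presheaf.stalk ξ) (hV.primeIdealOf ⟨ξ, hξV⟩).asIdeal :=
    hV.isLocalization_stalk ⟨ξ, hξV⟩
  haveI : (hV.primeIdealOf ⟨ξ, hξV⟩).asIdeal.IsMaximal := hV.primeIdealOf_isMaximal_of_isClosed ⟨ξ, hξV⟩ hξ
  haveI : IsScalarTower K Γ(Z, V) (Z.presheaf.stalk ξ) :=
    IsScalarTower.of_algebraMap_eq (R := K) (S := Γ(Z, V)) (A := Z.presheaf.stalk ξ) fun c => by
      show stalkHom φ₀ ξ c = (Z.presheaf.germ V ξ hξV).hom (sectionsHom φ₀ V c)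
      rw [← germ_comp_sectionsHom φ₀ V ξ hξV]
      rfl
  exact exists_isDiffOpLE_isUnit_pow_of_etaleCoordinates K (σ := Fin d) (hV.primeIdealOf ⟨ξ, hξV⟩).asIdeal
    (Z.presheaf.stalk ξ) h1 h2 e

/-- **`Diff^{≤ eN}((h^e)) = 𝒪_{Z,ξ}`** at a closed point `ξ` of a smooth scheme over a perfect field `K`, for `h` of
`𝔪_ξ`-adic order exactly `N` (the tree's `diffIdeal` for the `K`-structure `K → Γ(Z,𝒪_Z) → 𝒪_{Z,ξ}`).
[cite: VillamayorU2008ReesDiff, §4.1 and Remark 4.3] -/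
theorem diffIdeal_span_singleton_pow_stalk_eq_top_of_smooth [PerfectField K] [Smooth f] (ξ : Z)
    (hξ : IsClosed ({ξ} : Set Z)) {N : ℕ} {h : Z.presheaf.stalk ξ}
    (h1 : h ∈ maximalIdeal (Z.presheaf.stalk ξ) ^ N) (h2 : h ∉ maximalIdeal (Z.presheaf.stalk ξ) ^ (N + 1))
    (e : ℕ) :
    letI := stalkAlgebra (f.appTop.hom.comp (Scheme.ΓSpecIso (.of K)).inv.hom) ξ
    diffIdeal K (e * N) (Ideal.span {h ^ e}) = ⊤ := by
  letI := stalkAlgebra (f.appTop.hom.comp (Scheme.ΓSpecIso (.of K)).inv.hom) ξ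
  obtain ⟨D, hD, hunit⟩ := exists_isDiffOpLE_isUnit_pow_stalk_of_smooth f ξ hξ h1 h2 e
  exact Ideal.eq_top_of_isUnit_mem _ (apply_mem_diffIdeal K hD (Ideal.mem_span_singleton_self _)) hunit

/-- **Ideal form of the order criterion** at a closed point `ξ` of a smooth scheme over a perfect field `K`:
`Diff^{≤ n}(J)_ξ = 𝒪_{Z,ξ}` iff `J ⊄ 𝔪_ξ^{n+1}`, i.e. iff `ord_ξ(J) ≤ n` (the tree's `diffIdeal` for the
`K`-structure `K → Γ(Z,𝒪_Z) → 𝒪_{Z,ξ}`). The direction ⇒ is `diffIdeal_le_of_le_pow_succ` (operators of order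
`≤ n` send `𝔪^{n+1}` into `𝔪`); ⇐ takes `h ∈ J ∖ 𝔪^{n+1}`, its exact order `N ≤ n`, and an operator of order `≤ N`
with `D h` a unit (`exists_isDiffOpLE_isUnit_pow_stalk_of_smooth` with `e = 1`). This is the classical description of
`Sing(J, b) = {ξ : ord_ξ J ≥ b}` as the zero locus of `Diff^{≤ b−1}(J)`. [cite: VillamayorU2008ReesDiff, §4.1 and
Remark 4.3] [cite: EGAIV4, §16.8 and Thm. 16.11.2] -/
theorem diffIdeal_stalk_eq_top_iff_not_le_pow_of_smooth [PerfectField K] [Smooth f] (ξ : Z)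
    (hξ : IsClosed ({ξ} : Set Z)) (n : ℕ) (J : Ideal (Z.presheaf.stalk ξ)) :
    letI := stalkAlgebra (f.appTop.hom.comp (Scheme.ΓSpecIso (.of K)).inv.hom) ξ
    diffIdeal K n J = ⊤ ↔ ¬ J ≤ maximalIdeal (Z.presheaf.stalk ξ) ^ (n + 1) := by
  letI := stalkAlgebra (f.appTop.hom.comp (Scheme.ΓSpecIso (.of K)).inv.hom) ξ
  constructor
  · intro htop hle
    have h1 : diffIdeal K n J ≤ maximalIdeal (Z.presheaf.stalk ξ) := diffIdeal_le_of_le_pow_succ K hle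
    rw [htop, top_le_iff] at h1
    exact (maximalIdeal.isMaximal (Z.presheaf.stalk ξ)).ne_top h1
  · intro hnot
    obtain ⟨h, hJ, hh⟩ := Set.not_subset.mp hnot
    -- the exact order `N ≤ n` of `h`
    have hex : ∃ N, h ∉ maximalIdeal (Z.presheaf.stalk ξ) ^ (N + 1) := ⟨n, hh⟩
    classical
    set N := Nat.find hex with hN
    have hN1 : h ∉ maximalIdeal (Z.presheaf.stalk ξ) ^ (N + 1) := Nat.find_spec hex
    have hNle : N ≤ n := Nat.find_min' hex hh
    have hN0 : h ∈ maximalIdeal (Z.presheaf.stalk ξ) ^ N := by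
      rcases Nat.eq_zero_or_pos N with h0 | hpos
      · rw [h0, pow_zero, Ideal.one_eq_top]; exact Submodule.mem_top
      · obtain ⟨N', hN'⟩ := Nat.exists_eq_succ_of_ne_zero (Nat.pos_iff_ne_zero.mp hpos)
        have hmin := Nat.find_min hex (show N' < Nat.find hex by rw [← hN, hN']; exact Nat.lt_succ_self N')
        rw [hN']
        exact not_not.mp hmin
    obtain ⟨D, hD, hunit⟩ := exists_isDiffOpLE_isUnit_pow_stalk_of_smooth f ξ hξ hN0 hN1 1
    rw [one_mul] at hD
    rw [pow_one] at hunit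
    exact Ideal.eq_top_of_isUnit_mem _ (apply_mem_diffIdeal K (hD.of_le hNle) hJ) hunit

end Literature.AlgebraicGeometry.Resolution

end
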